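import Literature.NumberTheory.GaloisRepresentations.LiftingObstructionContinuous
import Literature.NumberTheory.GaloisRepresentations.RestrictedRamification
import Literature.NumberTheory.GaloisRepresentations.NearlyOrdinaryDeformationRing
import HarnessLib

/-!
# The global obstruction to lifting `ρ_𝒟 mod 𝔪ⁿ` through a small extension

Topic `Literature/NumberTheory/GaloisRepresentations`.  Let `𝓡` be a universal nearly ordinary
deformation ring of a residual datum `𝒟` (`NearlyOrdinaryDeformationRing.lean`), `n ≥ 0`, and
`R_n = R_𝒟/𝔪ⁿ`.  The reduction `ρ_n = ρ_𝒟 mod 𝔪ⁿ : Γ_F → GL₂(R_n)` has OPEN kernel (profinite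
continuity of `ρ_𝒟`, `IsAdicContinuous`) and is unramified outside `S = 𝒟.S`, hence descends to
the Galois group `G_{F,S}` with restricted ramification (`RestrictedRamification.lean`).  For a
surjection `q : B ↠ R_n` of rings with square-zero kernel `I` (`B` discrete; in Böckle's proof
`B = 𝒪⟦T⟧/(J_u + 𝔪ⁿ)`), Mazur's obstruction class of this descended representation
(`LiftingObstructionContinuous.lean`),

  `globalObstruction 𝓡 n q ∈ H²_cont(G_{F,S}, M₂(I)) = H²(G_{F,S}, ad ρ̄ ⊗ I)`,

is the GLOBAL obstruction of B. Mazur, *Deforming Galois representations* (1989), §1.6 (proof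
of Prop. 2) for the group `Π = G_{F,S}` — the first component of the obstruction behind
G. Böckle, *Presentations of universal deformation rings* (2007), (1) and Thm. 3.1: **if it
vanishes, `ρ_𝒟 mod 𝔪ⁿ` lifts to a homomorphism `Γ_F → GL₂(B)` with open kernel, unramified
outside `S`** (`exists_lift_of_globalObstruction_eq_zero`), i.e. to a lift of `ρ̄` to `B` in the
sense of the unrestricted deformation functor `Def_{S,𝒪}`; conversely such a lift kills the class
(`globalObstruction_eq_zero_of_lift`).  (The nearly ordinary conditions at `v ∣ p` contribute
further, local, obstructions — Böckle §7 — not treated here.)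

Everything is proved; no named facts.

## References

* B. Mazur, *Deforming Galois representations*, MSRI Publ. 16 (1989), §1.2 (deformations of
  `G_{F,S}`-representations) and §1.6 (Prop. 2 and its proof). [cite: Mazur1989Deforming, §1.6 Prop. 2]
* G. Böckle, *Presentations of universal deformation rings*, LMS LNS 320 (2007), Thm. 2.2, (1),
  Thm. 3.1. [cite: Bockle2007Presentations, Theorem 2.2 and Theorem 3.1]
-/

noncomputable section

open scoped NumberField
open Field IsDedekindDomain IsLocalRing Topology

namespace Literature.NumberTheory.GaloisRepresentations

namespace NearlyOrdinaryDeformationRing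

variable {F : Type} [Field F] [NumberField F] {p : ℕ} {𝒪 : Type} [CommRing 𝒪] {k : Type}
  [Field k] [Algebra 𝒪 k] {𝒟 : NearlyOrdinaryDatum F p 𝒪 k}
  (𝓡 : NearlyOrdinaryDeformationRing.{0} 𝒟)

/-! ## 1. `ρ_𝒟 mod 𝔪ⁿ` and its descent to `G_{F,S}` -/

/-- `ρ_𝒟 mod 𝔪ⁿ : Γ_F → GL₂(R_𝒟/𝔪ⁿ)`. [cite: Mazur1989Deforming, §1.6 Prop. 2] -/
def modPow (n : ℕ) : absoluteGaloisGroup F →* GL (Fin 2) (𝓡.R ⧸ maximalIdeal 𝓡.R ^ n) :=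
  (Matrix.GeneralLinearGroup.map (Ideal.Quotient.mk (maximalIdeal 𝓡.R ^ n))).comp 𝓡.ρ

/-- Unfolding `modPow`. [folklore] -/
@[simp] theorem modPow_apply (n : ℕ) (σ : absoluteGaloisGroup F) :
    𝓡.modPow n σ = Matrix.GeneralLinearGroup.map (Ideal.Quotient.mk (maximalIdeal 𝓡.R ^ n))
      (𝓡.ρ σ) :=
  rfl

/-- **`ρ_𝒟 mod 𝔪ⁿ` has open kernel** (profinite continuity of `ρ_𝒟`, `IsAdicContinuous`).
[cite: Mazur1997Deformation, §2] -/
theorem isOpen_ker_modPow (n : ℕ) :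
    IsOpen (((𝓡.modPow n).ker : Subgroup (absoluteGaloisGroup F)) :
      Set (absoluteGaloisGroup F)) :=
  𝓡.isLift.isAdicContinuous n

/-- `ρ_𝒟 mod 𝔪ⁿ` is unramified outside `S`. [cite: SkinnerWiles1999, §2.1] -/
theorem modPow_unramified (n : ℕ) :
    ∀ v ∉ 𝒟.S, ∀ 𝔓 ∈ v.primesAbove, ∀ σ ∈ 𝔓.inertia (absoluteGaloisGroup F),
      𝓡.modPow n σ = 1 := by
  intro v hv 𝔓 h𝔓 σ hσ
  rw [modPow_apply, 𝓡.isLift.unramified v hv 𝔓 h𝔓 σ hσ, map_one]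

/-- **`ρ_𝒟 mod 𝔪ⁿ` as a representation of `G_{F,S}`** (descent along `Γ_F ↠ G_{F,S}`,
`liftUnramified`). [cite: Mazur1989Deforming, §1.6 Prop. 2] -/
def modPowQuot (n : ℕ) :
    GaloisGroupUnramifiedOutside F 𝒟.S →* GL (Fin 2) (𝓡.R ⧸ maximalIdeal 𝓡.R ^ n) :=
  liftUnramified (𝓡.modPow n) (𝓡.isOpen_ker_modPow n) (𝓡.modPow_unramified n)

/-- `modPowQuot n ∘ (Γ_F ↠ G_{F,S}) = ρ_𝒟 mod 𝔪ⁿ`. [folklore] -/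
@[simp] theorem modPowQuot_mk (n : ℕ) (σ : absoluteGaloisGroup F) :
    𝓡.modPowQuot n (toUnramifiedQuot F 𝒟.S σ) = 𝓡.modPow n σ :=
  liftUnramified_mk _ _ _ σ

/-- The descended representation has open kernel. [folklore] -/
theorem isOpen_ker_modPowQuot (n : ℕ) :
    IsOpen (((𝓡.modPowQuot n).ker : Subgroup (GaloisGroupUnramifiedOutside F 𝒟.S)) :
      Set (GaloisGroupUnramifiedOutside F 𝒟.S)) :=
  isOpen_ker_liftUnramified _ _ _

/-! ## 2. The global obstruction class -/

section SmallExtension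

variable {n : ℕ} {B : Type} [CommRing B] [TopologicalSpace B] [DiscreteTopology B]
  {q : B →+* 𝓡.R ⧸ maximalIdeal 𝓡.R ^ n} (hq : Function.Surjective q)
  (hI : ∀ x ∈ RingHom.ker q, ∀ y ∈ RingHom.ker q, x * y = 0)

omit [TopologicalSpace B] [DiscreteTopology B] in
/-- A set-theoretic lift `GL₂(R_n) → GL₂(B)` of `GL₂(q)` (which is onto,
`generalLinearGroup_map_surjective`). [folklore] -/
def glSection : GL (Fin 2) (𝓡.R ⧸ maximalIdeal 𝓡.R ^ n) → GL (Fin 2) B :=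
  Function.surjInv (LiftingObstruction.generalLinearGroup_map_surjective hI hq)

omit [TopologicalSpace B] [DiscreteTopology B] in
/-- `glSection` is a section of `GL₂(q)`. [folklore] -/
theorem map_glSection (g : GL (Fin 2) (𝓡.R ⧸ maximalIdeal 𝓡.R ^ n)) :
    Matrix.GeneralLinearGroup.map q (𝓡.glSection hq hI g) = g :=
  Function.surjInv_eq (LiftingObstruction.generalLinearGroup_map_surjective hI hq) g

/-- **The global obstruction class** of `ρ_𝒟 mod 𝔪ⁿ` with respect to the small extension
`q : B ↠ R_𝒟/𝔪ⁿ`: Mazur's class `o(ρ_n) ∈ H²_cont(G_{F,S}, M₂(I)) = H²(G_{F,S}, ad ρ̄ ⊗ I)`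
(`LiftingObstruction.obstructionClass` for the profinite group `G_{F,S}`).
[cite: Mazur1989Deforming, §1.6 Prop. 2] [cite: Bockle2007Presentations, Theorem 2.2 and Theorem 3.1] -/
def globalObstruction :
    continuousCohomology 2 (LiftingObstruction.adKerRep hI (𝓡.map_glSection hq hI)
      (𝓡.modPowQuot n) (𝓡.isOpen_ker_modPowQuot n)).toTopRep :=
  LiftingObstruction.obstructionClass hI (𝓡.map_glSection hq hI) (𝓡.modPowQuot n)
    (𝓡.isOpen_ker_modPowQuot n)

/-- **Vanishing of the global obstruction lifts `ρ_𝒟 mod 𝔪ⁿ` to `B`, unramified outside `S`**: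
if `o(ρ_n) = 0` in `H²(G_{F,S}, ad ρ̄ ⊗ I)` then there is a homomorphism `ρ_B : Γ_F → GL₂(B)`
with `q ∘ ρ_B = ρ_𝒟 mod 𝔪ⁿ`, open kernel, and trivial on the inertia groups above every place
outside `S` (a lift of `ρ̄` to `B` for the unrestricted functor `Def_{S,𝒪}`).
[cite: Mazur1989Deforming, §1.6 Prop. 2] [cite: Bockle2007Presentations, Theorem 3.1] -/
theorem exists_lift_of_globalObstruction_eq_zero (h : 𝓡.globalObstruction hq hI = 0) :
    ∃ ρB : absoluteGaloisGroup F →* GL (Fin 2) B,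
      (∀ σ, Matrix.GeneralLinearGroup.map q (ρB σ) = 𝓡.modPow n σ) ∧
      IsOpen ((ρB.ker : Subgroup (absoluteGaloisGroup F)) : Set (absoluteGaloisGroup F)) ∧
      ∀ v ∉ 𝒟.S, Deformation.IsUnramifiedAt v ρB := by
  obtain ⟨ρ', hopen, hρ'⟩ := (LiftingObstruction.obstructionClass_eq_zero_iff hI
    (𝓡.map_glSection hq hI) (𝓡.modPowQuot n) (𝓡.isOpen_ker_modPowQuot n)).mp h
  refine ⟨ρ'.comp (toUnramifiedQuot F 𝒟.S), fun σ => ?_, isOpen_ker_comp_mk ρ' hopen,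
    fun v hv 𝔓 h𝔓 σ hσ => comp_mk_unramified ρ' hv h𝔓 hσ⟩
  rw [MonoidHom.comp_apply, hρ', modPowQuot_mk]

/-- Conversely, **a lift of `ρ_𝒟 mod 𝔪ⁿ` to `B`, with open kernel and unramified outside `S`,
kills the global obstruction.** [cite: Mazur1989Deforming, §1.6 Prop. 2] -/
theorem globalObstruction_eq_zero_of_lift (ρB : absoluteGaloisGroup F →* GL (Fin 2) B)
    (hq' : ∀ σ, Matrix.GeneralLinearGroup.map q (ρB σ) = 𝓡.modPow n σ)
    (hopen : IsOpen ((ρB.ker : Subgroup (absoluteGaloisGroup F)) : Set (absoluteGaloisGroup F)))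
    (hur : ∀ v ∉ 𝒟.S, Deformation.IsUnramifiedAt v ρB) :
    𝓡.globalObstruction hq hI = 0 := by
  refine (LiftingObstruction.obstructionClass_eq_zero_iff hI (𝓡.map_glSection hq hI)
    (𝓡.modPowQuot n) (𝓡.isOpen_ker_modPowQuot n)).mpr ?_
  refine ⟨liftUnramified ρB hopen (fun v hv 𝔓 h𝔓 σ hσ => hur v hv 𝔓 h𝔓 σ hσ),
    isOpen_ker_liftUnramified _ _ _, fun x => ?_⟩
  obtain ⟨σ, rfl⟩ := toUnramifiedQuot_surjective F 𝒟.S x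
  rw [liftUnramified_mk, modPowQuot_mk, hq']

end SmallExtension

end NearlyOrdinaryDeformationRing

end Literature.NumberTheory.GaloisRepresentations
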